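import Literature.IUT.LogVolume.AdaptedBasisRelative
import Literature.IUT.LogVolume.TensorPacketBaseExtension
import Literature.IUT.LogVolume.TensorPacketLattice
import Literature.IUT.LogVolume.LogRadius
import Literature.IUT.LogVolume.UnitLogIntoMaximalIdeal
import Literature.IUT.LogVolume.LocalFieldTraceRetraction
import HarnessLib

/-!
# Saturation of tensor packets of lattices, `φ⁻¹(⊗_i M'_i) = ⊗_i σ_i⁻¹(M'_i)`; the log-shell at TAME tuples
# ([IUTchIV] Prop. 1.2 (ii); G1-Θ item (X) with no lattice binder and no degree condition)

abc-iut cell, seat abc-iut-f-167 (gen 3; rung LADDER-ABC:A2.C, unit «(X)-TAME-SAT»).  Sequel to abc-iut-w5-d036's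
`TensorPacketBaseExtension.lean`: along a `ℚ_p`-algebra morphism of packets `φ : V = ⊗_{ℚ_p} k_i → V' = ⊗_{ℚ_p} k'_i`
given on the coprojections by field maps `σ_i : k_i → k'_i` (`φ(ι_i a) = ι'_i(σ_i a)`), the (Ind2)-orbit hull
volume of the slot-union is non-decreasing MODULO the lattice hypothesis `hsat : φ⁻¹(log_p(R'_I^×)) ⊆ log_p(R_I^×)`
("a `ℤ_p`-basis bookkeeping NOT proved in this file"); abc-iut-w5-d036's `LocalFieldTraceRetraction.lean` then
discharged `hsat` at tame factor pairs with `p ∤ [k'_i : k_i]` (normalised-trace retraction), recording as NOT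
covered "(a) `p ∣ [K_{v̲} : F_w]` at a tame prime — needs … Smith normal form with unit divisors".  THIS FILE does
(a): the lattice statement behind `hsat` in general, and `hsat` at every tame tuple with NO degree condition.

* `map_mem_packetOf` — `φ(⊗ M_i) ⊆ ⊗ M'_i` when `σ_i(M_i) ⊆ M'_i` (generators to generators);
* **`mem_packetOf_comap_of_map_mem_packetOf`**, **`comap_packetOf_eq`** (§4) — for compact open subgroups
  `M'_i ⊆ k'_i`: `φ⁻¹(⊗_i M'_i) = ⊗_i σ_i⁻¹(M'_i)` (`⊗` = abc-iut-S7's `packetOf`).  Proof: adapted bases make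
  `⊗ M'_i` a box lattice of a tensor basis (S7's `exists_adaptedBasis`, `packetOf_eq_boxLattice`); RELATIVE adapted
  bases in every factor (`AdaptedBasisRelative.exists_bases_adapted_of_injective`: elementary divisors of the
  saturated sublattice `M'_i ∩ σ_i(k_i)`) make `φ` map the tensor basis of `V` injectively INTO that tensor basis
  (`Basis.piTensorProduct`, w5-d036's `map_purePacket_of_iota`), so box membership is read off coordinatewise;
  **`mem_packetOf_of_map_mem_packetOf`** — FACTORWISE saturation `σ_i⁻¹(M'_i) ⊆ M_i` ⇒ PACKET saturation;
* **`mem_logUnits_of_map_mem_logUnits_of_tame`** (§5) — factorwise saturation of the log-shell: `p > 2`,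
  `e(K) ≤ p − 2`, `e(K') ≤ p − 1` ⇒ `σ⁻¹(log_p(R'^×)) ⊆ log_p(R^×)` (`log_p(R'^×) ⊆ 𝔪'`, `σ` isometric, `‖K^×‖ =
  p^{(1/e)ℤ}`, `𝔪 = p^{1/e}·R ⊆ log_p(R^×)` by Prop. 1.2 (i) with `a = 1/e`);
* **`mem_logPacket_of_map_mem_logPacket_of_tame`** — `hsat` at tame tuples (`p > 2`, `e(k_i) ≤ p − 2`,
  `e(k'_i) ≤ p − 1`, ANY degrees); **`packetLogμ_packetHull_orbit_slotUnion_le_of_tame`** — item (X) of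
  abc-iut-w5-d166's G1-Θ memo at every such tuple: `log μ̄(hull(⋃_γ γ·⋃_i ι_i(g_i)·(R_I)^∼)) ≤
  log μ̄'(hull'(⋃_{γ'} γ'·⋃_i ι'_i(σ_i g_i)·(R'_I)^∼))` — w5-d036's `…_of_sat` with `hsat` DISCHARGED (covers the
  exception set `p ∣ l(l²−1)` of `…_of_tame_of_not_dvd`; wild primes `e ≥ p − 1` and `p = 2` remain open, where
  factorwise saturation itself can fail);
* `packetLogμ_packetHull_orbit_slotUnion_le_of_tame'`, `…_of_tame_of_norm_eq` (§6) — the CONSUMER forms: the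
  packet morphism `⊗σ_i` supplied (w5-d036's `exists_packetAlgHom_of_algHom`), and big-side slots `g'_i` with
  `‖g'_i‖ = ‖g_i‖` instead of `σ_i(g_i)` (the shape the G1-Θ assembly consumes).

Classical lattice algebra; (Ind2)/the hull/`log μ̄` are the tree's typings of constructions of the disputed
corpus [claim: Mochizuki2012, status: disputed]; nothing here takes a side on [IUTchIII] Cor. 3.12; typed ≠
proved.  PROOF-ONLY file: no definitions, no `Prop` facts. [cite: Mochizuki2012, IUTchIV Prop. 1.2 (i)(ii) p. 10,
Thm 1.10 proof Step (v) p. 27–28] [cite: DupuyHilado2025, §4.7, §4.9, §4.12] [cite: WeilBNT1967, Ch. II §2, Th. 1]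
[cite: NeukirchANT1999, Ch. II (5.5)]
-/

noncomputable section

open Set Module
open scoped Pointwise TensorProduct
open Literature.NumberTheory.GaloisRepresentations.Ultrametric

namespace Literature.IUT.LogVolume

variable (p : ℕ) [Fact p.Prime]

/-! ## §4 Packets: factorwise saturation ⇒ saturation of `⊗ M_i ⊆ ⊗ k_i` along `φ` -/

section Packets

variable {I : Type} [Fintype I] [DecidableEq I] [Nonempty I]
variable (k : I → Type) [∀ i, NontriviallyNormedField (k i)] [∀ i, NormedAlgebra ℚ_[p] (k i)]
variable (k' : I → Type) [∀ i, NontriviallyNormedField (k' i)] [∀ i, NormedAlgebra ℚ_[p] (k' i)]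
  [∀ i, IsUltrametricDist (k' i)] [∀ i, ProperSpace (k' i)]
variable (φ : PacketAlgebra p k →ₐ[ℚ_[p]] PacketAlgebra p k')
variable (σ : ∀ i, k i →ₐ[ℚ_[p]] k' i) (hφ : ∀ (i : I) (a : k i), φ (iota p k i a) = iota p k' i (σ i a))
include hφ

omit [Nonempty I] [∀ i, IsUltrametricDist (k' i)] [∀ i, ProperSpace (k' i)] in
/-- **`φ(⊗ M_i) ⊆ ⊗ M'_i` whenever `σ_i(M_i) ⊆ M'_i`** (generators go to generators: `φ(⊗ z_i) = ⊗ σ_i(z_i)`).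
[cite: Mochizuki2012, IUTchIV Prop. 1.2 (ii) p. 10] -/
theorem map_mem_packetOf (M : Π i, AddSubgroup (k i)) (M' : Π i, AddSubgroup (k' i))
    (hMM' : ∀ (i : I) (a : k i), a ∈ M i → σ i a ∈ M' i) {x : PacketAlgebra p k}
    (hx : x ∈ packetOf p k M) : φ x ∈ packetOf p k' M' := by
  have h : packetOf p k M ≤
      (packetOf p k' M').comap ((φ : PacketAlgebra p k →ₐ[ℚ_[p]] PacketAlgebra p k') :
        PacketAlgebra p k →+ PacketAlgebra p k') := by
    rw [packetOf, AddSubgroup.closure_le]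
    rintro _ ⟨z, hz, rfl⟩
    rw [SetLike.mem_coe, AddSubgroup.mem_comap]
    change φ (purePacket p k z) ∈ packetOf p k' M'
    rw [map_purePacket_of_iota p k k' φ σ hφ]
    exact purePacket_mem_packetOf p k' M' fun i => hMM' i (z i) (hz i)
  exact h hx

/-- **Packet saturation from the target's lattices** ([IUTchIV] Prop. 1.2 (ii) bookkeeping): for compact open
subgroups `M'_i ⊆ k'_i` and a packet morphism `φ` given on the coprojections by field maps `σ_i`,
`φ(x) ∈ ⊗_i M'_i ⟹ x ∈ ⊗_i σ_i⁻¹(M'_i)`.  Proof: adapted bases (`exists_adaptedBasis`) make `⊗ M'_i` a box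
lattice of a tensor basis (`packetOf_eq_boxLattice`); relative adapted bases (`exists_bases_adapted_of_injective`,
elementary divisors of the saturated sublattices `M'_i ∩ σ_i(k_i)`) make `φ` send the tensor basis of `⊗ k_i`
injectively INTO that tensor basis, so coordinates — and box membership — are read off factorwise.
[cite: Mochizuki2012, IUTchIV Prop. 1.2 (ii) p. 10] [cite: WeilBNT1967, Ch. II §2, Th. 1] -/
theorem mem_packetOf_comap_of_map_mem_packetOf (M' : Π i, AddSubgroup (k' i))
    (hMo : ∀ i, IsOpen (M' i : Set (k' i))) (hMc : ∀ i, IsCompact (M' i : Set (k' i)))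
    {x : PacketAlgebra p k} (hx : φ x ∈ packetOf p k' M') :
    x ∈ packetOf p k fun i => (M' i).comap ((σ i : k i →ₐ[ℚ_[p]] k' i) : k i →+ k' i) := by
  -- adapted bases of the `M'_i`, then bases adapted to `σ_i(k_i) ⊆ k'_i`
  choose n₀ bZ b₀ c₀ hn₀ hbZ hM' using fun i => exists_adaptedBasis p (M' i) (hMo i) (hMc i)
  choose n b b' e hfe hbox using fun i =>
    exists_bases_adapted_of_injective p (b₀ i) (c₀ i) (σ i).toLinearMap (RingHom.injective (σ i).toRingHom)
  -- both packets are box lattices (all radii `1`) of the tensor bases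
  have hP' : packetOf p k' M' = PadicModule.boxLattice p (Basis.piTensorProduct b')
      (fun κ => ∏ i, (1 : Fin (n₀ i) → ℚ_[p]ˣ) (κ i)) :=
    packetOf_eq_boxLattice p k' b' (fun _ => 1) M' fun i y => by rw [hM' i y, hbox i]
  have hP : packetOf p k (fun i => (M' i).comap ((σ i : k i →ₐ[ℚ_[p]] k' i) : k i →+ k' i)) =
      PadicModule.boxLattice p (Basis.piTensorProduct b) (fun κ => ∏ i, (1 : Fin (n i) → ℚ_[p]ˣ) (κ i)) := by
    refine packetOf_eq_boxLattice p k b (fun _ => 1) _ fun i y => ?_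
    rw [AddSubgroup.mem_comap]
    change σ i y ∈ M' i ↔ _
    rw [hM' i, hbox i]
    exact map_mem_boxLattice_iff p (b i) (b' i) (σ i).toLinearMap (e i) (hfe i) 1 y
  -- `φ` sends the tensor basis of `⊗ k_i` injectively into that of `⊗ k'_i`
  have hφB : ∀ κ : Π i, Fin (n i), φ.toLinearMap (Basis.piTensorProduct b κ) =
      Basis.piTensorProduct b' (Function.Embedding.piCongrRight e κ) := fun κ => by
    rw [Basis.piTensorProduct_apply, Basis.piTensorProduct_apply, AlgHom.toLinearMap_apply]
    change φ (purePacket p k fun i => b i (κ i)) = purePacket p k' fun i => b' i (e i (κ i))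
    rw [map_purePacket_of_iota p k k' φ σ hφ]
    exact congrArg _ (funext fun i => hfe i (κ i))
  -- all radii are `1`
  have hone' : (fun κ : Π i, Fin (n₀ i) => ∏ i, (1 : Fin (n₀ i) → ℚ_[p]ˣ) (κ i)) = fun _ => 1 :=
    funext fun κ => Finset.prod_eq_one fun i _ => rfl
  have hone : (fun κ : Π i, Fin (n i) => ∏ i, (1 : Fin (n i) → ℚ_[p]ˣ) (κ i)) = fun _ => 1 :=
    funext fun κ => Finset.prod_eq_one fun i _ => rfl
  have hcomp : ((fun _ => (1 : ℚ_[p]ˣ)) ∘ (Function.Embedding.piCongrRight e :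
      (Π i, Fin (n i)) → Π i, Fin (n₀ i))) = fun _ => 1 := rfl
  rw [hP, hone]
  rw [hP', hone'] at hx
  have h := map_mem_boxLattice_iff p (Basis.piTensorProduct b) (Basis.piTensorProduct b') φ.toLinearMap
    (Function.Embedding.piCongrRight e) hφB (fun _ => 1) x
  rw [AlgHom.toLinearMap_apply, hcomp] at h
  exact h.mp hx

/-- **FACTORWISE SATURATION ⇒ PACKET SATURATION**: if `σ_i⁻¹(M'_i) ⊆ M_i` for every `i` (the `M'_i ⊆ k'_i`
compact open), then `φ⁻¹(⊗_i M'_i) ⊆ ⊗_i M_i`. [cite: Mochizuki2012, IUTchIV Prop. 1.2 (ii) p. 10]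
[cite: WeilBNT1967, Ch. II §2, Th. 1] -/
theorem mem_packetOf_of_map_mem_packetOf (M : Π i, AddSubgroup (k i)) (M' : Π i, AddSubgroup (k' i))
    (hMo : ∀ i, IsOpen (M' i : Set (k' i))) (hMc : ∀ i, IsCompact (M' i : Set (k' i)))
    (hsat : ∀ (i : I) (a : k i), σ i a ∈ M' i → a ∈ M i)
    {x : PacketAlgebra p k} (hx : φ x ∈ packetOf p k' M') : x ∈ packetOf p k M := by
  refine AddSubgroup.closure_mono ?_ (mem_packetOf_comap_of_map_mem_packetOf p k k' φ σ hφ M' hMo hMc hx)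
  rintro _ ⟨z, hz, rfl⟩
  exact ⟨z, fun i => hsat i (z i) (hz i), rfl⟩

/-- **`φ⁻¹(⊗_i M'_i) = ⊗_i σ_i⁻¹(M'_i)`** for compact open `M'_i ⊆ k'_i`.
[cite: Mochizuki2012, IUTchIV Prop. 1.2 (ii) p. 10] [cite: WeilBNT1967, Ch. II §2, Th. 1] -/
theorem comap_packetOf_eq (M' : Π i, AddSubgroup (k' i))
    (hMo : ∀ i, IsOpen (M' i : Set (k' i))) (hMc : ∀ i, IsCompact (M' i : Set (k' i))) :
    (packetOf p k' M').comap ((φ : PacketAlgebra p k →ₐ[ℚ_[p]] PacketAlgebra p k') :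
        PacketAlgebra p k →+ PacketAlgebra p k') =
      packetOf p k fun i => (M' i).comap ((σ i : k i →ₐ[ℚ_[p]] k' i) : k i →+ k' i) := by
  ext x
  rw [AddSubgroup.mem_comap]
  exact ⟨fun hx => mem_packetOf_comap_of_map_mem_packetOf p k k' φ σ hφ M' hMo hMc hx,
    fun hx => map_mem_packetOf p k k' φ σ hφ _ M' (fun i a ha => ha) hx⟩

end Packets

/-! ## §5 The log-shell lattice at tame tuples: `hsat` of `TensorPacketBaseExtension` discharged -/

section LogShell

variable {K K' : Type*} [NontriviallyNormedField K] [NormedAlgebra ℚ_[p] K] [IsUltrametricDist K]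
  [ProperSpace K] [NontriviallyNormedField K'] [NormedAlgebra ℚ_[p] K'] [IsUltrametricDist K']
  [ProperSpace K']

/-- **Factorwise saturation of the log-shell at a tame pair**: if `p > 2`, `e(K) ≤ p − 2` and `e(K') ≤ p − 1`,
then `σ⁻¹(log_p(R'^×)) ⊆ log_p(R^×)` for every `ℚ_p`-algebra map `σ : K → K'` — because `log_p(R'^×) ⊆ 𝔪_{K'}`,
`σ` is an isometry, the value group of `K` is `p^{(1/e)ℤ}`, and `p^{1/e}·R = 𝔪_K ⊆ log_p(R^×)` (Prop. 1.2 (i) with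
`a = 1/e`). [cite: Mochizuki2012, IUTchIV Prop. 1.2 (i) p. 10] [cite: NeukirchANT1999, Ch. II (5.5)] -/
theorem mem_logUnits_of_map_mem_logUnits_of_tame (hp : 2 < p) (he : absRamificationIdx p K ≤ p - 2)
    (he' : absRamificationIdx p K' ≤ p - 1) (σ : K →ₐ[ℚ_[p]] K') {a : K} (ha : σ a ∈ logUnits K') :
    a ∈ logUnits K := by
  have hlt : ‖σ a‖ < 1 := by
    have h := logUnits_subset_ball_of_absRamificationIdx_le p he' ha
    rwa [Metric.mem_ball, dist_zero_right] at h
  rw [norm_map_algHom σ a] at hlt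
  refine pBall_logRadiusA_subset_logUnits p K ?_
  rw [mem_pBall_iff, logRadiusA_eq hp (absRamificationIdx_pos p K) he]
  exact norm_le_rpow_of_norm_lt_one p K hlt

end LogShell

section TamePackets

variable {I : Type} [Fintype I] [DecidableEq I] [Nonempty I]
variable (k : I → Type) [∀ i, NontriviallyNormedField (k i)] [∀ i, NormedAlgebra ℚ_[p] (k i)]
  [∀ i, IsUltrametricDist (k i)] [∀ i, ProperSpace (k i)]
variable (k' : I → Type) [∀ i, NontriviallyNormedField (k' i)] [∀ i, NormedAlgebra ℚ_[p] (k' i)]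
  [∀ i, IsUltrametricDist (k' i)] [∀ i, ProperSpace (k' i)]
variable (φ : PacketAlgebra p k →ₐ[ℚ_[p]] PacketAlgebra p k')
variable (σ : ∀ i, k i →ₐ[ℚ_[p]] k' i) (hφ : ∀ (i : I) (a : k i), φ (iota p k i a) = iota p k' i (σ i a))
include hφ

/-- **`hsat` at tame tuples**: if `p > 2`, every `e(k_i) ≤ p − 2` and every `e(k'_i) ≤ p − 1`, then the log-shell
lattice is saturated along `φ`: `φ(x) ∈ log_p(R'_I^×) ⟹ x ∈ log_p(R_I^×)` (`log_p(R_I^×) = ⊗_i log_p(R_i^×)`,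
`logPacket_eq_packetOf`; factorwise `mem_logUnits_of_map_mem_logUnits_of_tame`; then §4).
[cite: Mochizuki2012, IUTchIV Prop. 1.2 (ii) p. 10] [cite: DupuyHilado2025, §4.9] -/
theorem mem_logPacket_of_map_mem_logPacket_of_tame (hp : 2 < p)
    (he : ∀ i, absRamificationIdx p (k i) ≤ p - 2) (he' : ∀ i, absRamificationIdx p (k' i) ≤ p - 1)
    {x : PacketAlgebra p k} (hx : φ x ∈ (logPacket p k' : Set (PacketAlgebra p k'))) :
    x ∈ (logPacket p k : Set (PacketAlgebra p k)) := by
  rw [SetLike.mem_coe, logPacket_eq_packetOf] at hx ⊢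
  refine mem_packetOf_of_map_mem_packetOf p k k' φ σ hφ _ _ (fun i => ?_) (fun i => ?_) (fun i a ha => ?_) hx
  · rw [coe_logUnitsAddSubgroup]; exact isOpen_logUnits p (k' i)
  · rw [coe_logUnitsAddSubgroup]; exact isCompact_logUnits p (k' i)
  · exact mem_logUnits_of_map_mem_logUnits_of_tame p hp (he i) (he' i) (σ i) ha

/-- **Item (X) at every TAME prime, with NO lattice binder**: for field embeddings `σ_i : k_i → k'_i`, a packet
morphism `φ` with `φ(ι_i(a)) = ι'_i(σ_i a)`, `p > 2`, `e(k_i) ≤ p − 2`, `e(k'_i) ≤ p − 1`, and slot elements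
`g_i ∈ k_i^×`: `log μ̄(hull(⋃_γ γ·⋃_i ι_i(g_i)·(R_I)^∼)) ≤ log μ̄'(hull'(⋃_{γ'} γ'·⋃_i ι'_i(σ_i g_i)·(R'_I)^∼))` —
abc-iut-w5-d036's `packetLogμ_packetHull_orbit_slotUnion_le_of_sat` with its `hsat` DISCHARGED.
[cite: Mochizuki2012, IUTchIV Thm 1.10 proof Step (v) p. 27–28] [cite: DupuyHilado2025, §4.7, §4.12] -/
theorem packetLogμ_packetHull_orbit_slotUnion_le_of_tame (hp : 2 < p)
    (he : ∀ i, absRamificationIdx p (k i) ≤ p - 2) (he' : ∀ i, absRamificationIdx p (k' i) ≤ p - 1)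
    (g : Π i, k i) (hg : ∀ i, g i ≠ 0) :
    packetLogμ p k (packetHull p k
        (⋃ γ : indTwo p k, γ • ⋃ i, iota p k i (g i) • (normalizedPacket p k : Set (PacketAlgebra p k)))) ≤
      packetLogμ p k' (packetHull p k'
        (⋃ γ : indTwo p k', γ • ⋃ i, iota p k' i (σ i (g i)) •
          (normalizedPacket p k' : Set (PacketAlgebra p k')))) :=
  packetLogμ_packetHull_orbit_slotUnion_le_of_sat p k k' φ σ hφ
    (fun _ hx => mem_logPacket_of_map_mem_logPacket_of_tame p k k' φ σ hφ hp he he' hx) g hg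

end TamePackets

/-! ## §6 Consumer forms: the packet morphism supplied, norm-matched big-side slots -/

section Consumer

variable {I : Type} [Fintype I] [DecidableEq I] [Nonempty I]
variable (k : I → Type) [∀ i, NontriviallyNormedField (k i)] [∀ i, NormedAlgebra ℚ_[p] (k i)]
  [∀ i, IsUltrametricDist (k i)] [∀ i, ProperSpace (k i)]
variable (k' : I → Type) [∀ i, NontriviallyNormedField (k' i)] [∀ i, NormedAlgebra ℚ_[p] (k' i)]
  [∀ i, IsUltrametricDist (k' i)] [∀ i, ProperSpace (k' i)]

/-- **Item (X) at every tame tuple, `σ`-only form**: `p > 2`, `e(k_i) ≤ p − 2`, `e(k'_i) ≤ p − 1`, field embeddings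
`σ_i : k_i → k'_i` (ANY degrees), `g_i ∈ k_i^×` ⇒ for the packet morphism `φ = ⊗σ_i` (which exists,
`exists_packetAlgHom_of_algHom`) `log μ̄(hull(⋃_γ γ·⋃_i ι_i(g_i)·(R_I)^∼)) ≤ log μ̄'(hull'(⋃_{γ'} γ'·⋃_i ι'_i(σ_i g_i)·(R'_I)^∼))`.
[cite: Mochizuki2012, IUTchIV Thm 1.10 proof Step (v) p. 27–28] [cite: DupuyHilado2025, §4.7, §4.12] -/
theorem packetLogμ_packetHull_orbit_slotUnion_le_of_tame' (hp : 2 < p)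
    (he : ∀ i, absRamificationIdx p (k i) ≤ p - 2) (he' : ∀ i, absRamificationIdx p (k' i) ≤ p - 1)
    (σ : ∀ i, k i →ₐ[ℚ_[p]] k' i) (g : Π i, k i) (hg : ∀ i, g i ≠ 0) :
    packetLogμ p k (packetHull p k
        (⋃ γ : indTwo p k, γ • ⋃ i, iota p k i (g i) • (normalizedPacket p k : Set (PacketAlgebra p k)))) ≤
      packetLogμ p k' (packetHull p k'
        (⋃ γ : indTwo p k', γ • ⋃ i, iota p k' i (σ i (g i)) •
          (normalizedPacket p k' : Set (PacketAlgebra p k')))) := by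
  obtain ⟨φ, hφ⟩ := exists_packetAlgHom_of_algHom p k k' σ
  exact packetLogμ_packetHull_orbit_slotUnion_le_of_tame p k k' φ σ hφ hp he he' g hg

/-- **Item (X) at every tame tuple, NORM-MATCHED form** (the small-field and big-field Θ-values are independent
realisations with EQUAL NORMS): `p > 2`, `e(k_i) ≤ p − 2`, `e(k'_i) ≤ p − 1`, `σ_i : k_i → k'_i` (ANY degrees),
`g_i ∈ k_i^×`, `g'_i ∈ k'_i` with `‖g'_i‖ = ‖g_i‖` ⇒
`log μ̄(hull(⋃_γ γ·⋃_i ι_i(g_i)·(R_I)^∼)) ≤ log μ̄'(hull'(⋃_{γ'} γ'·⋃_i ι'_i(g'_i)·(R'_I)^∼))` — w5-d036's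
`…_of_tame_of_not_dvd_of_norm_eq` WITHOUT `p ∤ [k'_i : k_i]`.
[cite: Mochizuki2012, IUTchIV Thm 1.10 proof Step (v) p. 27–28] [cite: DupuyHilado2025, §4.7, §4.9, §4.12] -/
theorem packetLogμ_packetHull_orbit_slotUnion_le_of_tame_of_norm_eq (hp : 2 < p)
    (he : ∀ i, absRamificationIdx p (k i) ≤ p - 2) (he' : ∀ i, absRamificationIdx p (k' i) ≤ p - 1)
    (σ : ∀ i, k i →ₐ[ℚ_[p]] k' i) (g : Π i, k i) (hg : ∀ i, g i ≠ 0) (g' : Π i, k' i)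
    (hgg' : ∀ i, ‖g' i‖ = ‖g i‖) :
    packetLogμ p k (packetHull p k
        (⋃ γ : indTwo p k, γ • ⋃ i, iota p k i (g i) • (normalizedPacket p k : Set (PacketAlgebra p k)))) ≤
      packetLogμ p k' (packetHull p k'
        (⋃ γ : indTwo p k', γ • ⋃ i, iota p k' i (g' i) • (normalizedPacket p k' : Set (PacketAlgebra p k')))) := by
  have hσg : ∀ i, σ i (g i) ≠ 0 := fun i => (map_ne_zero (σ i)).mpr (hg i)
  have hn' : ∀ i, ‖g' i‖ = ‖σ i (g i)‖ := fun i => by rw [hgg' i, norm_map_algHom (σ i) (g i)]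
  rw [iUnion_iota_smul_normalizedPacket_eq_of_norm_eq p k' (fun i => σ i (g i)) g' hσg hn']
  exact packetLogμ_packetHull_orbit_slotUnion_le_of_tame' p k k' hp he he' σ g hg

end Consumer

end Literature.IUT.LogVolume

end
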